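import Summits.Ventures.CertifiedManyBodySolver.Downfold.EmeryOrbitalWeightFaceCoordCert
import HarnessLib

/-!
# The fixed-energy COORDINATE LEVERS of the antinodal Fermi-surface Cu-d weight `w_face = t_pd²faceN/(t_pd²faceN + faceR)`:
# `Δ ↑` and `t_pp′ ↑` in the antinodal charge-transfer regime `4(t_pp + t_pp′) ≤ Δ + ε`, `t_pp ↓` on the hole-like window — three kernel-checked LP certificates

Venture CertifiedManyBodySolver, cell `pub/hubbard-downfold` (stage S1; INFLATION-RULES-3to1-B §B.73 (the antinodal weight in closed form and its doping lever), §B.90 (this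
file + `EmeryOrbitalWeightFaceBox`: the antinodal weight over a typed box — the kinematic leg of the UPPER member of the weak band-level `U` bracket of §B.72 (g)/(i))),
seat hubbard-downfold-mod-4 (technique B, g38); namespace `Summit.Ventures.CertifiedManyBodySolver.Downfold.Emery`. Sequel of `EmeryOrbitalWeightFace`
(`dWeightFace_eq`, `faceG`, `faceR_pos`, `dcharCubic_face_pos`). Everything PROVED (0 sorry): each lever is ONE polynomial identity (`ring`) whose right-hand side is a
positively weighted sum of products of monomials and window/regime forms (`positivity`); the weights were FOUND by linear programming (Handelman form, degree ≤ 2 in the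
forms; kit job j343376, dual simplex + exact repair), live in `EmeryOrbitalWeightFaceCoordCert` and are CHECKED here by `ring`, so nothing trusts the search.
WHAT THIS IS NOT: a statement about any material; `U = 0` one-body kinematics of the σ (d–pₓ–p_y + t_pp + t_pp′) model.

THE LEVERS (regime `Δ > 0`, `0 ≤ t_pp′ ≤ t_pp`, `t_pd ≠ 0`, `ε > 0`, margin `t_pp′ε < t_pd²`; `E = Δ + ε`, `g = t_pp + t_pp′`):
* §1 **Δ-lever** `dWeightFace_mono_Delta`: on the hole-like window `faceG(ε) ≥ 0` AND in the antinodal charge-transfer regime `4g ≤ E`, `w_face` is non-decreasing in `Δ`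
  (certificate `faceCertD`, 128 products in `{faceG, E − 4g, t_pd² − t_pp′ε}`, denominators ≤ 3). HONEST NOTE: the regime is SHARP as a sufficient condition — seat-side
  exact-rational sampling finds sign violations with `E/4g → 1⁻` (at `Δ ≲ t_pd`, `t_pp ≳ 0.4t_pd`) and none with `E ≥ 4g` (3.3·10⁵ window samples).
* §2 **t_pp-lever** `dWeightFace_anti_tpp`: on the hole-like window `w_face` is non-increasing in `t_pp` — more in-plane O–O dispersion ⇒ a less Cu-like antinodal state
  (certificate `faceCertB`, 47 products in `{faceG, t_pd² − t_pp′ε}`, INTEGER weights; no regime condition).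
* §3 **t_pp′-lever** `dWeightFace_mono_tppP`: on the hole-like window and in the regime (at the larger `t_pp′`), `w_face` is non-decreasing in `t_pp′` (certificate `faceCertC`,
  130 products, denominators ≤ 9).
* The t_pd-lever at fixed energy (`w_face ↑ in t_pd` on the upper-edge window, 0 violations in 7·10⁵ samples) has NO Handelman certificate of degree ≤ 3 in
  `{upper edge, margin}` and is not needed: at fixed FILLING the t_pd coordinate is removed by the scaling law (`EmeryOrbitalWeightFaceBox` §1).
Compare the node (`EmeryOrbitalWeightNodeBox`): there all four levers are one-line identities and unconditional; at the antinode the `Δ` and `t_pp′` levers need the regime.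

Sources: three-band model [HybertsenSchluterChristensen1989, Eq. (1)]; face point of the bilinear contour [AndersenEtAl1995, §6]; Handelman/Positivstellensatz certificates
[folklore] (Handelman 1988, Pac. J. Math. 132); [folklore] algebra.
-/

noncomputable section

namespace Summit.Ventures.CertifiedManyBodySolver.Downfold.Emery

open Real Set

/-! ## §0 The closed form as a fraction with a positive denominator -/

/-- On the window (`Δ + ε > 0`, `0 ≤ t_pp′ ≤ t_pp`, `ε > 0`, `t_pp′ε < t_pd²`, `faceG ≥ 0`): `dWeightFace = t_pd²faceN/(t_pd²faceN + faceR)` with `t_pd²faceN > 0` (for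
`t_pd ≠ 0`) and `faceR > 0`. [folklore] -/
theorem dWeightFace_eq_frac {Δ tpd tpp c ε : ℝ} (hE : 0 < Δ + ε) (hc : 0 ≤ c) (hct : c ≤ tpp) (hε : 0 < ε) (hm : c * ε < tpd ^ 2)
    (hG : 0 ≤ faceG Δ tpd c ε) :
    dWeightFace Δ tpd tpp c ε = tpd ^ 2 * faceN Δ tpp c ε / (tpd ^ 2 * faceN Δ tpp c ε + faceR Δ tpd tpp c ε) ∧
      0 < faceR Δ tpd tpp c ε ∧ 0 ≤ tpd ^ 2 * faceN Δ tpp c ε := by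
  have hD : 0 < fsD Δ tpd c ε := fsD_pos hE hm
  have hF : 0 < 4 * fsD Δ tpd c ε + 16 * fsN tpd tpp c ε := by have := fsN_nonneg (tpd := tpd) hc hct hε.le; positivity
  have hR := faceR_pos hE hc hct hε hm hG
  have hN := faceN_pos (Δ := Δ) (ε := ε) hE (by linarith : 0 ≤ tpp + c)
  exact ⟨dWeightFace_eq hε.ne' hF.ne' (dcharCubic_face_pos hE hc hct hε hm hG).ne', hR, by positivity⟩

/-- Cross-multiplication: for `N, N′ ≥ 0`, `R, R′ > 0`: `N/(N + R) ≤ N′/(N′ + R′) ↔ 0 ≤ N′R − NR′`. [folklore] -/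
theorem frac_le_frac_iff_cross {N N' R R' : ℝ} (hN : 0 ≤ N) (hN' : 0 ≤ N') (hR : 0 < R) (hR' : 0 < R') :
    N / (N + R) ≤ N' / (N' + R') ↔ 0 ≤ N' * R - N * R' := by
  rw [div_le_div_iff₀ (by positivity) (by positivity)]
  constructor <;> intro h <;> nlinarith

/-! ## §1 The Δ-lever (hole-like window + antinodal charge-transfer regime) -/


/-- **THE Δ-CERTIFICATE IDENTITY**: `faceN(Δ + δ)·faceR(Δ) − faceN(Δ)·faceR(Δ + δ) = δ·faceCertD(…, faceG(ε), Δ + ε − 4(t_pp + t_pp′), t_pd² − t_pp′ε)` identically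
(`t_pp = c + h`). [folklore] -/
theorem faceN_faceR_cross_Delta (Δ δ ε tpd c h : ℝ) :
    faceN (Δ + δ) (c + h) c ε * faceR Δ tpd (c + h) c ε - faceN Δ (c + h) c ε * faceR (Δ + δ) tpd (c + h) c ε =
      δ * faceCertD Δ δ ε tpd c h (ε * (Δ + ε) + 4 * c * ε - 4 * tpd ^ 2) (Δ + ε - 4 * ((c + h) + c)) (tpd ^ 2 - c * ε) := by
  unfold faceN faceR fsN faceCertD faceCertDP1 faceCertDP2 faceCertDP3 faceCertDP4 faceCertDP5
  ring

/-- **Δ-LEVER OF THE ANTINODAL Cu-d WEIGHT** (fixed energy): `Δ > 0`, `0 ≤ t_pp′ ≤ t_pp`, `t_pd ≠ 0`, `ε > 0`, `t_pp′ε < t_pd²`, the `ε`-contour of row `Δ` hole-like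
(`faceG ≥ 0`) and the antinodal charge-transfer regime `4(t_pp + t_pp′) ≤ Δ + ε` ⇒ for every `Δ′ ≥ Δ`: **`dWeightFace(Δ) ≤ dWeightFace(Δ′)`** — a larger charge-transfer
energy at fixed band energy makes the antinodal state more Cu-like. [folklore] -/
theorem dWeightFace_mono_Delta {Δ Δ' tpd tpp c ε : ℝ} (hΔ : 0 < Δ) (hΔΔ : Δ ≤ Δ') (hc : 0 ≤ c) (hct : c ≤ tpp) (hε : 0 < ε)
    (hm : c * ε < tpd ^ 2) (hG : 0 ≤ faceG Δ tpd c ε) (hR : 4 * (tpp + c) ≤ Δ + ε) :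
    dWeightFace Δ tpd tpp c ε ≤ dWeightFace Δ' tpd tpp c ε := by
  obtain ⟨h, rfl⟩ : ∃ h, tpp = c + h := ⟨tpp - c, by ring⟩
  obtain ⟨δ, rfl⟩ : ∃ δ, Δ' = Δ + δ := ⟨Δ' - Δ, by ring⟩
  have hh : 0 ≤ h := by linarith
  have hδ : 0 ≤ δ := by linarith
  have hG' : 0 ≤ faceG (Δ + δ) tpd c ε := by
    have e : faceG (Δ + δ) tpd c ε = faceG Δ tpd c ε + ε * δ := by unfold faceG; ring
    rw [e]; positivity
  obtain ⟨e1, hR1, hN1⟩ := dWeightFace_eq_frac (tpp := c + h) (by linarith) hc hct hε hm hG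
  obtain ⟨e2, hR2, hN2⟩ := dWeightFace_eq_frac (tpp := c + h) (by linarith) hc hct hε hm hG'
  rw [e1, e2, frac_le_frac_iff_cross hN1 hN2 hR1 hR2]
  have key := faceN_faceR_cross_Delta Δ δ ε tpd c h
  have hGv : 0 ≤ ε * (Δ + ε) + 4 * c * ε - 4 * tpd ^ 2 := by unfold faceG at hG; linarith
  have hRv : 0 ≤ Δ + ε - 4 * ((c + h) + c) := by linarith
  have hMv : 0 ≤ tpd ^ 2 - c * ε := by linarith
  have hcert := faceCertD_nonneg (tpd := tpd) (hΔ := hΔ.le) (hδ := hδ) (hε := hε.le) (hc := hc) (hh := hh) (hG := hGv) (hR := hRv) (hM := hMv)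
  have e : tpd ^ 2 * faceN (Δ + δ) (c + h) c ε * faceR Δ tpd (c + h) c ε - tpd ^ 2 * faceN Δ (c + h) c ε * faceR (Δ + δ) tpd (c + h) c ε =
      tpd ^ 2 * (δ * faceCertD Δ δ ε tpd c h (ε * (Δ + ε) + 4 * c * ε - 4 * tpd ^ 2) (Δ + ε - 4 * ((c + h) + c)) (tpd ^ 2 - c * ε)) := by
    rw [← key]; ring
  have hnn : 0 ≤ tpd ^ 2 * (δ * faceCertD Δ δ ε tpd c h (ε * (Δ + ε) + 4 * c * ε - 4 * tpd ^ 2) (Δ + ε - 4 * ((c + h) + c)) (tpd ^ 2 - c * ε)) :=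
    mul_nonneg (sq_nonneg _) (mul_nonneg hδ hcert)
  linarith

/-! ## §2 The t_pp-lever (hole-like window) -/


/-- **THE t_pp-CERTIFICATE IDENTITY**: `faceN(t_pp)·faceR(t_pp + β) − faceN(t_pp + β)·faceR(t_pp) = β·faceCertB(…, faceG(ε), t_pd² − t_pp′ε)` identically (`t_pp = c + h`).
[folklore] -/
theorem faceN_faceR_cross_tpp (Δ ε tpd c h β : ℝ) :
    faceN Δ (c + h) c ε * faceR Δ tpd (c + h + β) c ε - faceN Δ (c + h + β) c ε * faceR Δ tpd (c + h) c ε =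
      β * faceCertB Δ ε tpd c h β (ε * (Δ + ε) + 4 * c * ε - 4 * tpd ^ 2) (tpd ^ 2 - c * ε) := by
  unfold faceN faceR fsN faceCertB faceCertBP1 faceCertBP2
  ring

/-- **t_pp-LEVER OF THE ANTINODAL Cu-d WEIGHT** (fixed energy): `Δ > 0`, `0 ≤ t_pp′ ≤ t_pp ≤ t_pp″`, `t_pd ≠ 0`, `ε > 0`, `t_pp′ε < t_pd²`, hole-like window
`faceG(ε) ≥ 0` ⇒ **`dWeightFace(t_pp″) ≤ dWeightFace(t_pp)`** — more in-plane O–O dispersion makes the antinodal state less Cu-like (as at the node). [folklore] -/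
theorem dWeightFace_anti_tpp {Δ tpd tpp tpp' c ε : ℝ} (hΔ : 0 < Δ) (hc : 0 ≤ c) (hct : c ≤ tpp) (htt : tpp ≤ tpp') (hε : 0 < ε)
    (hm : c * ε < tpd ^ 2) (hG : 0 ≤ faceG Δ tpd c ε) :
    dWeightFace Δ tpd tpp' c ε ≤ dWeightFace Δ tpd tpp c ε := by
  obtain ⟨h, rfl⟩ : ∃ h, tpp = c + h := ⟨tpp - c, by ring⟩
  obtain ⟨β, rfl⟩ : ∃ β, tpp' = c + h + β := ⟨tpp' - (c + h), by ring⟩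
  have hh : 0 ≤ h := by linarith
  have hβ : 0 ≤ β := by linarith
  obtain ⟨e1, hR1, hN1⟩ := dWeightFace_eq_frac (tpp := c + h + β) (by linarith) hc (by linarith) hε hm hG
  obtain ⟨e2, hR2, hN2⟩ := dWeightFace_eq_frac (tpp := c + h) (by linarith) hc hct hε hm hG
  rw [e1, e2, frac_le_frac_iff_cross hN1 hN2 hR1 hR2]
  have key := faceN_faceR_cross_tpp Δ ε tpd c h β
  have hGv : 0 ≤ ε * (Δ + ε) + 4 * c * ε - 4 * tpd ^ 2 := by unfold faceG at hG; linarith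
  have hcert := faceCertB_nonneg (tpd := tpd) (M := tpd ^ 2 - c * ε) (hΔ := hΔ.le) (hε := hε.le) (hc := hc) (hh := hh) (hβ := hβ) (hG := hGv)
  have e : tpd ^ 2 * faceN Δ (c + h) c ε * faceR Δ tpd (c + h + β) c ε - tpd ^ 2 * faceN Δ (c + h + β) c ε * faceR Δ tpd (c + h) c ε =
      tpd ^ 2 * (β * faceCertB Δ ε tpd c h β (ε * (Δ + ε) + 4 * c * ε - 4 * tpd ^ 2) (tpd ^ 2 - c * ε)) := by
    rw [← key]; ring
  have hnn : 0 ≤ tpd ^ 2 * (β * faceCertB Δ ε tpd c h β (ε * (Δ + ε) + 4 * c * ε - 4 * tpd ^ 2) (tpd ^ 2 - c * ε)) :=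
    mul_nonneg (sq_nonneg _) (mul_nonneg hβ hcert)
  linarith

/-! ## §3 The t_pp′-lever (hole-like window + antinodal charge-transfer regime) -/


/-- **THE t_pp′-CERTIFICATE IDENTITY**: `faceN(c + γ)·faceR(c) − faceN(c)·faceR(c + γ) = γ·faceCertC(…, faceG(c; ε), Δ + ε − 4(t_pp + c + γ), t_pd² − (c + γ)ε)` identically
(`t_pp = c + γ + h` fixed; `faceN` sees `t_pp′` through `g = t_pp + t_pp′`). [folklore] -/
theorem faceN_faceR_cross_tppP (Δ ε tpd c γ h : ℝ) :
    faceN Δ (c + γ + h) (c + γ) ε * faceR Δ tpd (c + γ + h) c ε - faceN Δ (c + γ + h) c ε * faceR Δ tpd (c + γ + h) (c + γ) ε =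
      γ * faceCertC Δ ε tpd c γ h (ε * (Δ + ε) + 4 * c * ε - 4 * tpd ^ 2) (Δ + ε - 4 * ((c + γ + h) + (c + γ))) (tpd ^ 2 - (c + γ) * ε) := by
  unfold faceN faceR fsN faceCertC faceCertCP1 faceCertCP2 faceCertCP3 faceCertCP4 faceCertCP5
  ring

/-- **t_pp′-LEVER OF THE ANTINODAL Cu-d WEIGHT** (fixed energy): `Δ > 0`, `0 ≤ c ≤ c′ ≤ t_pp`, `t_pd ≠ 0`, `ε > 0`, `c′ε < t_pd²`, the `ε`-contour of row `c` hole-like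
(`faceG(c; ε) ≥ 0`) and the regime at `c′` (`4(t_pp + c′) ≤ Δ + ε`) ⇒ **`dWeightFace(c) ≤ dWeightFace(c′)`**. [folklore] -/
theorem dWeightFace_mono_tppP {Δ tpd tpp c c' ε : ℝ} (hΔ : 0 < Δ) (hc : 0 ≤ c) (hcc : c ≤ c') (hct : c' ≤ tpp) (hε : 0 < ε)
    (hm : c' * ε < tpd ^ 2) (hG : 0 ≤ faceG Δ tpd c ε) (hR : 4 * (tpp + c') ≤ Δ + ε) :
    dWeightFace Δ tpd tpp c ε ≤ dWeightFace Δ tpd tpp c' ε := by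
  obtain ⟨γ, rfl⟩ : ∃ γ, c' = c + γ := ⟨c' - c, by ring⟩
  obtain ⟨h, rfl⟩ : ∃ h, tpp = c + γ + h := ⟨tpp - (c + γ), by ring⟩
  have hγ : 0 ≤ γ := by linarith
  have hh : 0 ≤ h := by linarith
  have hm0 : c * ε < tpd ^ 2 := lt_of_le_of_lt (mul_le_mul_of_nonneg_right hcc hε.le) hm
  have hG' : 0 ≤ faceG Δ tpd (c + γ) ε := by
    have e : faceG Δ tpd (c + γ) ε = faceG Δ tpd c ε + 4 * γ * ε := by unfold faceG; ring
    rw [e]; positivity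
  obtain ⟨e1, hR1, hN1⟩ := dWeightFace_eq_frac (tpp := c + γ + h) (by linarith) hc (by linarith) hε hm0 hG
  obtain ⟨e2, hR2, hN2⟩ := dWeightFace_eq_frac (tpp := c + γ + h) (by linarith) (by linarith : 0 ≤ c + γ) (by linarith) hε hm hG'
  rw [e1, e2, frac_le_frac_iff_cross hN1 hN2 hR1 hR2]
  have key := faceN_faceR_cross_tppP Δ ε tpd c γ h
  have hGv : 0 ≤ ε * (Δ + ε) + 4 * c * ε - 4 * tpd ^ 2 := by unfold faceG at hG; linarith
  have hRv : 0 ≤ Δ + ε - 4 * ((c + γ + h) + (c + γ)) := by linarith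
  have hMv : 0 ≤ tpd ^ 2 - (c + γ) * ε := by linarith
  have hcert := faceCertC_nonneg (tpd := tpd) (hΔ := hΔ.le) (hε := hε.le) (hc := hc) (hγ := hγ) (hh := hh) (hG := hGv) (hR := hRv) (hM := hMv)
  have e : tpd ^ 2 * faceN Δ (c + γ + h) (c + γ) ε * faceR Δ tpd (c + γ + h) c ε -
      tpd ^ 2 * faceN Δ (c + γ + h) c ε * faceR Δ tpd (c + γ + h) (c + γ) ε =
      tpd ^ 2 * (γ * faceCertC Δ ε tpd c γ h (ε * (Δ + ε) + 4 * c * ε - 4 * tpd ^ 2) (Δ + ε - 4 * ((c + γ + h) + (c + γ))) (tpd ^ 2 - (c + γ) * ε)) := by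
    rw [← key]; ring
  have hnn : 0 ≤ tpd ^ 2 * (γ * faceCertC Δ ε tpd c γ h (ε * (Δ + ε) + 4 * c * ε - 4 * tpd ^ 2) (Δ + ε - 4 * ((c + γ + h) + (c + γ))) (tpd ^ 2 - (c + γ) * ε)) :=
    mul_nonneg (sq_nonneg _) (mul_nonneg hγ hcert)
  linarith

end Summit.Ventures.CertifiedManyBodySolver.Downfold.Emery
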